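import Summits.CriticalPhenomena.PercolationContinuityZ3.Theorems.SahiMasterFamilyFCombOneSharedData
import Summits.CriticalPhenomena.PercolationContinuityZ3.Theorems.PercNearOneGluingNoHeavyLowerTailThreePartitionVOrderUnitMatchingFinset

/-!
# SCHEME Σ: the unit map `φ` of a one-shared-coordinate pair and its target signature (support file)

Support file (prover seat `prim-bnk-2`, gen 31–32; `--supports stmt-CriticalPhenomena-4575`).  Plan:
`run/shared/lean/prim/prim-l12/prim-bnk-2/SIGMA-ASSEMBLY-PLAN.md`; proof document `PROOF-THEOREM-I1.md` §2 (the nine source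
classes (S1)–(S9)) and §3 (injectivity by target signatures).

A one-shared-coordinate pair is packaged as `OneShared ι`: coordinate blocks `I`, `J`, the shared coordinate `e`, and the two
families `B` (depends on `I + e`) and `C` (depends on `J + e`) of finsets, up-closed.  Using the chosen data of `…OneSharedData`
(`dataI`, `dataJ`, `kh`, `rout`) this file DEFINES the map `φ` on typed units `((x, y), t)` (faces `(x,y)`, `z = (x ∪ y)ᶜ`,
`t = 0,1,2` for `T1, T2, T3`; unit sets `ThreePartition.negUnitSetF` / `posUnitSetF` of `…VOrderUnitMatchingFinset`) by the case
table of the proof document; outside the intended branches `φ u = u`.  It also defines the **target signature** `sig` (which of the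
thirteen target classes a unit belongs to), the tool of the injectivity proof.  Admissibility and injectivity (PROOF-THEOREM-I1 §2
✓adm, §3) are proved in the companion files.  Definitions, with their unfolding / evaluation lemmas; no `sorry`.
-/

namespace Summit.CriticalPhenomena.PercolationContinuityZ3.Theorems

namespace SahiFComb.Shift

open Finset FinsetFamily
open scoped Classical

variable {ι : Type*} [Fintype ι] [DecidableEq ι] [LinearOrder ι]

/-- A one-shared-coordinate pair (PROOF-THEOREM-I1 §0): disjoint blocks `I, J` and the shared coordinate `e ∉ I ∪ J`
covering the ground type, and two up-closed families of finsets, `B` depending only on the coordinates `I + e` and `C`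
depending only on `J + e`. [this work] -/
structure OneShared (ι : Type*) [Fintype ι] [DecidableEq ι] [LinearOrder ι] where
  /-- the `I`-block -/
  I : Finset ι
  /-- the `J`-block -/
  J : Finset ι
  /-- the shared coordinate -/
  e : ι
  /-- the family `B = 𝒱` as finsets -/
  B : Finset (Finset ι)
  /-- the family `C = 𝒲` as finsets -/
  C : Finset (Finset ι)
  hBup : ∀ s ∈ B, ∀ s', s ⊆ s' → s' ⊆ (univ : Finset ι) → s' ∈ B
  hCup : ∀ s ∈ C, ∀ s', s ⊆ s' → s' ⊆ (univ : Finset ι) → s' ∈ C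
  hIJ : Disjoint I J
  heI : e ∉ I
  heJ : e ∉ J
  hcov : ∀ i, i = e ∨ i ∈ I ∨ i ∈ J
  hdepB : ∀ s : Finset ι, s ∈ B ↔ s ∩ insert e I ∈ B
  hdepC : ∀ s : Finset ι, s ∈ C ↔ s ∩ insert e J ∈ C

namespace OneShared

variable (S : OneShared ι)

/-- I-side cube data of a column with second part `y`: cube `R = I \ (y ∩ I)`, list `R.sort`. [this work] -/
noncomputable def dataI (y : Finset ι) : CubeData (S.I \ (y ∩ S.I)) S.e S.B ((S.I \ (y ∩ S.I)).sort (· ≤ ·)) :=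
  cubeData S.hBup (subset_univ _) (mem_univ _) (sort_nodup _ _) (fun _ ha => (mem_sort _).1 ha)
    (fun _ ha => (mem_sort _).2 ha)

/-- J-side cube data on the cube `J \ v` (columns: `v = y ∩ J`; rows: `v = x ∩ J`), list `(J.sort).filter (· ∈ J \ v)`. [this work] -/
noncomputable def dataJ (v : Finset ι) : CubeData (S.J \ v) S.e S.C ((S.J.sort (· ≤ ·)).filter (· ∈ S.J \ v)) :=
  cubeData S.hCup (subset_univ _) (mem_univ _) (sort_filter_enumerates S.J v).1 (sort_filter_enumerates S.J v).2.1
    (sort_filter_enumerates S.J v).2.2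

/-- Row Kleitman–Hall data on the cube `(J \ xJ) + e` (the family `C′` of PROOF-THEOREM-I1). [this work] -/
noncomputable def kh (xJ : Finset ι) : KHData (insert S.e (S.J \ xJ)) S.C := khData S.hCup (subset_univ _)

/-- The routing data of LEMMA J**. [this work] -/
noncomputable def rout : RoutingData S.J S.e S.C := routingData S.J S.e S.C

/-- The leaver target (class S9b): for a unit at the face `(x, y)` with `x_J = x ∩ J`, `y_J = y ∩ J`, `z_J = (J \ x_J) \ y_J` and
slot `(w', t') = ρ (x_J, z_J)`: the `T1⁺` unit at `(Φ_ℓ(x_I) ∪ t' ∪ {e}, (y ∩ I) ∪ w')`. [this work] -/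
noncomputable def leaverMap (u : (Finset ι × Finset ι) × ℕ) : (Finset ι × Finset ι) × ℕ :=
  if h𝓟 : (u.1.1 ∩ S.J, (S.J \ (u.1.1 ∩ S.J)) \ (u.1.2 ∩ S.J)) ∈ S.rout.𝓟 then
    if hI : u.1.1 ∩ S.I ∈ (secHigh (S.I \ (u.1.2 ∩ S.I)) S.e S.B \ secLow (S.I \ (u.1.2 ∩ S.I)) S.B).image
        fun t => (S.I \ (u.1.2 ∩ S.I)) \ t then
      (((((S.dataI u.1.2).Φl ⟨u.1.1 ∩ S.I, hI⟩ : Finset ι) ∪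
          ((S.rout.ρ ⟨_, h𝓟⟩ : ↥S.rout.𝓟) : Finset ι × Finset ι).2) ∪ {S.e},
        (u.1.2 ∩ S.I) ∪ ((S.rout.ρ ⟨_, h𝓟⟩ : ↥S.rout.𝓟) : Finset ι × Finset ι).1), 0)
    else u
  else u

/-- The leaver class (S9b), as a set of units: `T3⁻` units with `e ∈ z`, `z_I ∉ B⁰` and `y_J ∈ A_{x_J}`. [this work] -/
def leaverSet : Set ((Finset ι × Finset ι) × ℕ) :=
  {u | u ∈ ThreePartition.negUnitSetF S.B S.C ∧ u.2 = 2 ∧ S.e ∉ u.1.1 ∧ S.e ∉ u.1.2 ∧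
    (S.I \ (u.1.2 ∩ S.I)) \ (u.1.1 ∩ S.I) ∉ secLow (S.I \ (u.1.2 ∩ S.I)) S.B ∧
    u.1.2 ∩ S.J ∈ (S.dataJ (u.1.1 ∩ S.J)).A}

/-- Membership in the leaver class, unfolded. [this work] -/
theorem mem_leaverSet (u : (Finset ι × Finset ι) × ℕ) :
    u ∈ S.leaverSet ↔ u ∈ ThreePartition.negUnitSetF S.B S.C ∧ u.2 = 2 ∧ S.e ∉ u.1.1 ∧ S.e ∉ u.1.2 ∧
      (S.I \ (u.1.2 ∩ S.I)) \ (u.1.1 ∩ S.I) ∉ secLow (S.I \ (u.1.2 ∩ S.I)) S.B ∧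
      u.1.2 ∩ S.J ∈ (S.dataJ (u.1.1 ∩ S.J)).A := Iff.rfl

/-- The set of leaver targets (used for the displacement rule of class S4b). [this work] -/
noncomputable def leaverTargets : Finset ((Finset ι × Finset ι) × ℕ) :=
  ((univ : Finset (Finset ι × Finset ι)).filter fun q => (q, 2) ∈ S.leaverSet).image fun q => S.leaverMap (q, 2)

/-- **The unit map `φ` of SCHEME Σ** (PROOF-THEOREM-I1 §2).  Notation for `u = ((x, y), t)`: `η = y ∩ I`, `R = I \ η`,
`x_I = x ∩ I`; `w = y ∩ J`, `x_J = x ∩ J`, `y_J = y ∩ J`; the I-data of the column are `dataI y` (cube `R`), the J-data of the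
column `dataJ w` (cube `J \ w`), the row data `dataJ x_J` (cube `J \ x_J`) and `kh x_J`. [this work] -/
noncomputable def phi (u : (Finset ι × Finset ι) × ℕ) : (Finset ι × Finset ι) × ℕ :=
  let x := u.1.1
  let y := u.1.2
  let R := S.I \ (y ∩ S.I)
  let xI := x ∩ S.I
  let Rw := S.J \ (y ∩ S.J)
  let xJ := x ∩ S.J
  let yJ := y ∩ S.J
  let dI := S.dataI y
  let dJ := S.dataJ (y ∩ S.J)
  let dR := S.dataJ (x ∩ S.J)
  if u.2 = 0 then
    if S.e ∈ y then
      -- (S1) column Kleitman–Hall for `B⁰|_R`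
      if h : xI ∈ (secLow R S.B).image (fun t => R \ t) \ secLow R S.B then
        (((x \ S.I) ∪ (dI.g₀ ⟨xI, h⟩ : Finset ι), y), 0) else u
    else if S.e ∈ x then
      -- (S3) `Φ_c`
      if h : xI ∈ (secLow R S.B).image (fun t => R \ t) \ secHigh R S.e S.B then
        (((x \ S.I) ∪ (dI.Φc ⟨xI, h⟩ : Finset ι), y), 0) else u
    else
      -- (S4) `e ∈ z`
      if h : xI ∈ dI.A then
        -- (S4b) preferred `G_T` (move `e` to `x`), displaced to `τ` (type `T2⁺`) if a leaver takes the unit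
        if (((x \ S.I) ∪ (dI.GT ⟨xI, h⟩ : Finset ι) ∪ {S.e}, y), 0) ∈ S.leaverTargets then
          (((x \ S.I) ∪ (dI.τ ⟨xI, h⟩ : Finset ι) ∪ {S.e}, y), 1)
        else (((x \ S.I) ∪ (dI.GT ⟨xI, h⟩ : Finset ι) ∪ {S.e}, y), 0)
      else if h' : xI ∈ ((secHigh R S.e S.B).image (fun t => R \ t) \ secLow R S.B) \ dI.A then
        -- (S4a) `G_b`
        (((x \ S.I) ∪ (dI.Gb ⟨xI, h'⟩ : Finset ι), y), 0)
      else u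
  else if u.2 = 1 then
    if S.e ∈ y then
      -- (S2) column Kleitman–Hall for `C⁰|_{J \ w}`
      if h : xJ ∈ (secLow Rw S.C).image (fun t => Rw \ t) \ secLow Rw S.C then
        (((x \ S.J) ∪ (dJ.g₀ ⟨xJ, h⟩ : Finset ι), y), 1) else u
    else if S.e ∈ x then
      -- (S5) `Φ′_w`
      if h : xJ ∈ (secLow Rw S.C).image (fun t => Rw \ t) \ secHigh Rw S.e S.C then
        (((x \ S.J) ∪ (dJ.Φc ⟨xJ, h⟩ : Finset ι), y), 1) else u
    else
      if h : xJ ∈ dJ.A then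
        -- (S6b) `G′_w`, `e` moves to `x`
        (((x \ S.J) ∪ (dJ.GT ⟨xJ, h⟩ : Finset ι) ∪ {S.e}, y), 1)
      else if h' : xJ ∈ ((secHigh Rw S.e S.C).image (fun t => Rw \ t) \ secLow Rw S.C) \ dJ.A then
        -- (S6a) `M_w`
        (((x \ S.J) ∪ (dJ.Gb ⟨xJ, h'⟩ : Finset ι), y), 1)
      else u
  else if u.2 = 2 then
    if S.e ∈ x then
      -- (S7) row Kleitman–Hall for `C⁰|_{J \ x_J}`
      if h : yJ ∈ (secLow (S.J \ xJ) S.C).image (fun t => (S.J \ xJ) \ t) \ secLow (S.J \ xJ) S.C then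
        ((x, (y \ S.J) ∪ (dR.g₀ ⟨yJ, h⟩ : Finset ι)), 2) else u
    else if R \ xI ∈ secLow R S.B then
      -- (S8) `z_I ∈ B⁰`: full row Kleitman–Hall on `(J \ x_J) + e`, applied to `ỹ = y \ I`
      if h : y \ S.I ∈ (secLow (insert S.e (S.J \ xJ)) S.C).image (fun t => insert S.e (S.J \ xJ) \ t) \
          secLow (insert S.e (S.J \ xJ)) S.C then
        ((x, (y ∩ S.I) ∪ ((S.kh xJ).g ⟨y \ S.I, h⟩ : Finset ι)), 2) else u
    else if u ∈ S.leaverSet then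
      -- (S9b) leaver
      S.leaverMap u
    else if h : yJ ∈ ((secHigh (S.J \ xJ) S.e S.C).image (fun t => (S.J \ xJ) \ t) \ secLow (S.J \ xJ) S.C) \ dR.A then
      -- (S9a) `M_{x_J}`
      ((x, (y \ S.J) ∪ (dR.Gb ⟨yJ, h⟩ : Finset ι)), 2)
    else u
  else u

/-- **Target signature** (PROOF-THEOREM-I1 §3).  For a unit `v = ((x', y'), t')` with `η' = y' ∩ I`, `R' = I \ η'`,
`R'_w = J \ (y' ∩ J)`: the class of sources of `φ` that can produce `v` — `1` (S1), `2` (S2), `3` (S3), `4` (S4a),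
`5` (S4b, preferred unit `π`), `6` (S4b, displaced unit `α`), `7` (S5), `8` (S6a), `9` (S6b), `10` (S7), `11` (S8), `12` (S9a),
`13` (S9b) — read off from `t'`, the position of `e`, and the classes `x'_I ∈ T = σ_{R'} A`, `x'_J ∈ T_w = σ A_w`,
`x'_I ∈ B⁰|_{R'}`, `z'_I ∈ B⁰|_{R'}`, `v ∈ leaverTargets`.  `sig (φ u)` determines the class of a negative unit `u`, and `φ` is
injective on each class (companion files). [this work] -/
noncomputable def sig (v : (Finset ι × Finset ι) × ℕ) : ℕ :=
  let x := v.1.1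
  let y := v.1.2
  let R := S.I \ (y ∩ S.I)
  let Rw := S.J \ (y ∩ S.J)
  if v.2 = 0 then
    if S.e ∈ y then 1
    else if S.e ∈ x then
      if x ∩ S.I ∈ (S.dataI y).A.image (fun t => R \ t) then (if v ∈ S.leaverTargets then 13 else 5) else 3
    else 4
  else if v.2 = 1 then
    if S.e ∈ y then 2
    else if S.e ∈ x then
      if x ∩ S.J ∈ (S.dataJ (y ∩ S.J)).A.image (fun t => Rw \ t) then (if x ∩ S.I ∈ secLow R S.B then 9 else 6) else 7
    else 8
  else
    if S.e ∈ x then 10 else if R \ (x ∩ S.I) ∈ secLow R S.B then 11 else 12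

/-! ### Evaluation of the signature -/

section Sig

variable {v : (Finset ι × Finset ι) × ℕ}

/-- `sig = 1`: type `T1`, `e ∈ y'`. [this work] -/
theorem sig_eq_1 (ht : v.2 = 0) (hey : S.e ∈ v.1.2) : S.sig v = 1 := by
  unfold sig; simp only [ht, hey, if_true]

/-- `sig = 3`: type `T1`, `e ∈ x'`, `x'_I ∉ T`. [this work] -/
theorem sig_eq_3 (ht : v.2 = 0) (hey : S.e ∉ v.1.2) (hex : S.e ∈ v.1.1)
    (hT : v.1.1 ∩ S.I ∉ (S.dataI v.1.2).A.image (fun t => (S.I \ (v.1.2 ∩ S.I)) \ t)) : S.sig v = 3 := by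
  unfold sig; simp only [ht, hey, hex, hT, if_true, if_false]

/-- `sig = 4`: type `T1`, `e ∈ z'`. [this work] -/
theorem sig_eq_4 (ht : v.2 = 0) (hey : S.e ∉ v.1.2) (hex : S.e ∉ v.1.1) : S.sig v = 4 := by
  unfold sig; simp only [ht, hey, hex, if_true, if_false]

/-- `sig = 5`: type `T1`, `e ∈ x'`, `x'_I ∈ T`, not a leaver target. [this work] -/
theorem sig_eq_5 (ht : v.2 = 0) (hey : S.e ∉ v.1.2) (hex : S.e ∈ v.1.1)
    (hT : v.1.1 ∩ S.I ∈ (S.dataI v.1.2).A.image (fun t => (S.I \ (v.1.2 ∩ S.I)) \ t)) (hL : v ∉ S.leaverTargets) :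
    S.sig v = 5 := by
  unfold sig; simp only [ht, hey, hex, hT, hL, if_true, if_false]

/-- `sig = 13`: type `T1`, `e ∈ x'`, `x'_I ∈ T`, a leaver target. [this work] -/
theorem sig_eq_13 (ht : v.2 = 0) (hey : S.e ∉ v.1.2) (hex : S.e ∈ v.1.1)
    (hT : v.1.1 ∩ S.I ∈ (S.dataI v.1.2).A.image (fun t => (S.I \ (v.1.2 ∩ S.I)) \ t)) (hL : v ∈ S.leaverTargets) :
    S.sig v = 13 := by
  unfold sig; simp only [ht, hey, hex, hT, hL, if_true, if_false]

/-- `sig = 2`: type `T2`, `e ∈ y'`. [this work] -/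
theorem sig_eq_2 (ht : v.2 = 1) (hey : S.e ∈ v.1.2) : S.sig v = 2 := by
  unfold sig; simp only [ht, hey, if_true, if_false, Nat.one_ne_zero]

/-- `sig = 7`: type `T2`, `e ∈ x'`, `x'_J ∉ T_w`. [this work] -/
theorem sig_eq_7 (ht : v.2 = 1) (hey : S.e ∉ v.1.2) (hex : S.e ∈ v.1.1)
    (hT : v.1.1 ∩ S.J ∉ (S.dataJ (v.1.2 ∩ S.J)).A.image (fun t => (S.J \ (v.1.2 ∩ S.J)) \ t)) : S.sig v = 7 := by
  unfold sig; simp only [ht, hey, hex, hT, if_true, if_false, Nat.one_ne_zero]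

/-- `sig = 8`: type `T2`, `e ∈ z'`. [this work] -/
theorem sig_eq_8 (ht : v.2 = 1) (hey : S.e ∉ v.1.2) (hex : S.e ∉ v.1.1) : S.sig v = 8 := by
  unfold sig; simp only [ht, hey, hex, if_true, if_false, Nat.one_ne_zero]

/-- `sig = 9`: type `T2`, `e ∈ x'`, `x'_J ∈ T_w`, `x'_I ∈ B⁰|_{R'}`. [this work] -/
theorem sig_eq_9 (ht : v.2 = 1) (hey : S.e ∉ v.1.2) (hex : S.e ∈ v.1.1)
    (hT : v.1.1 ∩ S.J ∈ (S.dataJ (v.1.2 ∩ S.J)).A.image (fun t => (S.J \ (v.1.2 ∩ S.J)) \ t))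
    (hP : v.1.1 ∩ S.I ∈ secLow (S.I \ (v.1.2 ∩ S.I)) S.B) : S.sig v = 9 := by
  unfold sig; simp only [ht, hey, hex, hT, hP, if_true, if_false, Nat.one_ne_zero]

/-- `sig = 6`: type `T2`, `e ∈ x'`, `x'_J ∈ T_w`, `x'_I ∉ B⁰|_{R'}`. [this work] -/
theorem sig_eq_6 (ht : v.2 = 1) (hey : S.e ∉ v.1.2) (hex : S.e ∈ v.1.1)
    (hT : v.1.1 ∩ S.J ∈ (S.dataJ (v.1.2 ∩ S.J)).A.image (fun t => (S.J \ (v.1.2 ∩ S.J)) \ t))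
    (hP : v.1.1 ∩ S.I ∉ secLow (S.I \ (v.1.2 ∩ S.I)) S.B) : S.sig v = 6 := by
  unfold sig; simp only [ht, hey, hex, hT, hP, if_true, if_false, Nat.one_ne_zero]

/-- `sig = 10`: type `T3`, `e ∈ x'`. [this work] -/
theorem sig_eq_10 (ht : v.2 = 2) (hex : S.e ∈ v.1.1) : S.sig v = 10 := by
  unfold sig
  simp only [ht, hex, if_true, if_false, show ((2 : ℕ) = 0) = False by simp, show ((2 : ℕ) = 1) = False by simp]

/-- `sig = 11`: type `T3`, `e ∉ x'`, `z'_I ∈ B⁰|_{R'}`. [this work] -/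
theorem sig_eq_11 (ht : v.2 = 2) (hex : S.e ∉ v.1.1)
    (hP : (S.I \ (v.1.2 ∩ S.I)) \ (v.1.1 ∩ S.I) ∈ secLow (S.I \ (v.1.2 ∩ S.I)) S.B) : S.sig v = 11 := by
  unfold sig
  simp only [ht, hex, hP, if_true, if_false, show ((2 : ℕ) = 0) = False by simp, show ((2 : ℕ) = 1) = False by simp]

/-- `sig = 12`: type `T3`, `e ∉ x'`, `z'_I ∉ B⁰|_{R'}`. [this work] -/
theorem sig_eq_12 (ht : v.2 = 2) (hex : S.e ∉ v.1.1)
    (hP : (S.I \ (v.1.2 ∩ S.I)) \ (v.1.1 ∩ S.I) ∉ secLow (S.I \ (v.1.2 ∩ S.I)) S.B) : S.sig v = 12 := by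
  unfold sig
  simp only [ht, hex, hP, if_false, show ((2 : ℕ) = 0) = False by simp, show ((2 : ℕ) = 1) = False by simp]

end Sig

end OneShared

end SahiFComb.Shift

end Summit.CriticalPhenomena.PercolationContinuityZ3.Theorems
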